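import Summits.AtomisticToContinuum.HydrodynamicLimit.Theorems.LambertianContactSwapLambertianEulerHearts
import Summits.AtomisticToContinuum.HydrodynamicLimit.Theses.ImplosionDichotomy
import Summits.AtomisticToContinuum.HydrodynamicLimit.Theorems.LambertianContactSwapLambertianEulerWindowLedger
import Summits.AtomisticToContinuum.HydrodynamicLimit.Theorems.LambertianContactSwapLambertianEulerAprioriEntropyBound
import Summits.AtomisticToContinuum.HydrodynamicLimit.Theorems.LambertianContactSwapLambertianEulerExpectedWindowProductionTools
import Summits.AtomisticToContinuum.HydrodynamicLimit.Theorems.LambertianContactSwapLambertianEulerProductionSplit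
import Summits.AtomisticToContinuum.HydrodynamicLimit.Theorems.ImplosionDichotomyPolynomialCompressionEosRatioAnalytic
import HarnessLib

/-!
# Hearts ⇒ ESTIMATE: the in-window bootstrap of the Lambertian entropy clock (line `Sketch`, crux stmt-11854)

Support file (`--supports stmt-AtomisticToContinuum-11854`).  `windowProductionEstimateLambda_of_hearts`: the kinetic heart P3Λ, the
collisional heart P4Λ (`…LambertianEulerHearts`) and the shared item `ImplosionDichotomy.DiluteSelfConsistency` (stmt-3091) imply Yau's
one-window production ESTIMATE for `Λ` on the explicit functional `Δ log Zpos − E_λ[∫ΣDg] − E_λ[Σ compensated jumps]`.  Ingredients, all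
landed: the production split B2 `E_λ[∫ΣDg] = E_λ[∫ΣY⊥] − E_λ[∫ΣX]` (p133972), the a priori entropy bound (p125903), the one-window ledger
(p122335) + FORMULA (p128635) over a sub-interval (`ledgerFormula_Hent`), the analytic insertion factor (`stub_eosRatioAnalytic`) for the
joint smoothness of the activity `ρ·Rf(σ³ρ)` (`isSmoothSpaceTimeOn_activityRf`), uniform profile bounds on `[0,t]` by compactness through
`log`, ONE bootstrap of the window supremum, and the pure-ℝ bookkeeping `estimate_arith_full/partial` (constants `A = 2(C₃+C₄)`,
`w(ε) = min 1 (ε/(2C²C₀+2CC₀+1))` constant in `N`, `ε₁ = wε/(4(Cw+1))`).  Verbatim the skeleton's §2c (lead c5, v30), with the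
registered stubs replaced by the named hearts.  Lead c6, 2026-08-17.  [cite: Yau1991, §2]
-/

noncomputable section

namespace Summit.AtomisticToContinuum.HydrodynamicLimit.Theorems.LambertianContactSwapLambertianEulerEstimateOfHearts

open scoped BigOperators Topology ENNReal InnerProductSpace
open MeasureTheory ProbabilityTheory Filter Set InformationTheory
open Literature.MathematicalPhysics.KineticTheory
open Literature.Analysis.FluidPDE Literature.Analysis.FluidPDE.Alexander
open Summit.AtomisticToContinuum.HydrodynamicLimit.Theorems.ClampedCurrentsDockPathwise (gSum DgSum)
open Summit.AtomisticToContinuum.HydrodynamicLimit.Theorems.LambertianContactSwapLambertianEulerHearts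

/-! ## §1 The ledger through the FORMULA, the activity's smoothness -/

/-- GLUE (proved, v30). **The ledger of `Λ` over a sub-interval, through the FORMULA**: along the explicit reference family,
`H_N(r′) − H_N(s) ≤ Δ log Zpos − E_λ[∫_s^{r′} Σ Dg] − E_λ[Σ compensated jumps]` for `0 ≤ s ≤ r′ < T`
(`Summit.AtomisticToContinuum.HydrodynamicLimit.Theorems.LambertianContactSwapLambertianEulerWindowLedger.stub_windowLedgerLambda` p122335 at the window `(s, r′ − s)` + `Summit.AtomisticToContinuum.HydrodynamicLimit.Theorems.LambertianContactSwapLambertianEulerExpectedWindowProduction.stub_expectedWindowProductionLambda` p128635). [cite: Yau1991, §2] -/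
theorem ledgerFormula_Hent {σ : ℝ} (hσ : 0 < σ) (hσi : σ < 2⁻¹) {a₀ θ₀ : T3 → ℝ} {u₀ : T3 → V3}
    (ha : Continuous a₀) (hθ : Continuous θ₀) (hu : Continuous u₀) (ha0 : ∀ x, 0 < a₀ x) (hθ0 : ∀ x, 0 < θ₀ x)
    {T : ℝ} {ρ θ : ℝ → T3 → ℝ} {u : ℝ → T3 → V3} {Rf : ℝ → ℝ} (hE : IsHardSphereEulerSolution σ T ρ u θ)
    (hsmooth : Literature.Analysis.FunctionSpaces.Torus.IsSmoothSpaceTimeOn (Set.Ico 0 T)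
      (fun r' x => ρ r' x * Rf (σ ^ 3 * ρ r' x)))
    (hapos : ∀ t' ∈ Set.Ico 0 T, ∀ x, 0 < ρ t' x * Rf (σ ^ 3 * ρ t' x))
    (N : ℕ) (Φ : HardSphereFlow (Torus.geometry (Fin 3)) (hsDiameter σ N) (N + 1)) {s r' : ℝ}
    (hs : 0 ≤ s) (hsr' : s ≤ r') (hr'T : r' < T) :
    Hent σ a₀ θ₀ u₀ Rf ρ θ u N Φ r' - Hent σ a₀ θ₀ u₀ Rf ρ θ u N Φ s ≤
      dLZ σ Rf ρ N s r' - Sint σ a₀ θ₀ u₀ Rf ρ θ u T N Φ s r' - Jmp σ a₀ θ₀ u₀ Rf ρ θ u N Φ s r' := by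
  have hsT : s ∈ Set.Ico 0 T := ⟨hs, hsr'.trans_lt hr'T⟩
  have hr'I : r' ∈ Set.Ico 0 T := ⟨hs.trans hsr', hr'T⟩
  have hsr'T : s + (r' - s) < T := by linarith
  have hbc : Continuous fun x => ρ s x * Rf (σ ^ 3 * ρ s x) := (hsmooth.isSmooth_slice hsT).continuous
  have hθc : Continuous (θ s) := (hE.smooth_temperature.isSmooth_slice hsT).continuous
  have huc : Continuous (u s) := (hE.smooth_velocity.isSmooth_slice hsT).continuous
  have hbc' : Continuous fun x => ρ r' x * Rf (σ ^ 3 * ρ r' x) := (hsmooth.isSmooth_slice hr'I).continuous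
  have hθc' : Continuous (θ r') := (hE.smooth_temperature.isSmooth_slice hr'I).continuous
  have huc' : Continuous (u r') := (hE.smooth_velocity.isSmooth_slice hr'I).continuous
  have hled := (Summit.AtomisticToContinuum.HydrodynamicLimit.Theorems.LambertianContactSwapLambertianEulerWindowLedger.stub_windowLedgerLambda hσ hσi ha hθ hu ha0 hθ0 hbc hθc huc (hapos s hsT)
    (hE.temperature_pos s hsT) hbc' hθc' huc' (hapos r' hr'I) (hE.temperature_pos r' hr'I) N Φ
    s (r' - s) hs (sub_nonneg.2 hsr')).2
  have hF := (Summit.AtomisticToContinuum.HydrodynamicLimit.Theorems.LambertianContactSwapLambertianEulerExpectedWindowProduction.stub_expectedWindowProductionLambda hσ hσi ha hθ hu ha0 hθ0 T N Φ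
    (fun r' x => ρ r' x * Rf (σ ^ 3 * ρ r' x)) θ u hsmooth hE.smooth_temperature hE.smooth_velocity
    hapos hE.temperature_pos s (r' - s) hs (sub_nonneg.2 hsr') hsr'T).2.2
  beta_reduce at hF
  simp only [show s + (r' - s) = r' by ring] at hled hF
  rw [hF] at hled
  exact hled


/-- GLUE (proved, v26). **The explicit reference family's activity is jointly smooth**: the handed-over insertion
factor `Rf` agrees on `(0, min r r')` with the tree's ANALYTIC insertion factor (`Theorems.stub_eosRatioAnalytic`: power
series at `0` on the ball of radius `r'`, `1 ≤ Rf' ≤ 2` on `[0, r']`, solving the same equation) by the uniqueness clause,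
so `Rf` is `C^∞` on the open interval `(0, η)`, `η = min r r'`, and `(t, x) ↦ ρ_t(x) · Rf(σ³ρ_t(x))` is jointly smooth
whenever `ρ` is and `0 < σ³ρ < η` (`IsSmoothSpaceTimeOn.comp_contDiffOn`, `.mul`). [folklore] -/
theorem isSmoothSpaceTimeOn_activityRf {r : ℝ} {Rf : ℝ → ℝ} (hr : 0 < r)
    (huniq : ∀ x ∈ Set.Ioo (-r) r, ∀ R ∈ Set.Icc (1 / 2 : ℝ) 2,
      R * (∑' j : ℕ, bE j / (j.factorial : ℝ) * (x * R) ^ j) = 1 → R = Rf x) :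
    ∃ η : ℝ, 0 < η ∧ η ≤ r ∧ ∀ {T σ : ℝ} {ρ : ℝ → T3 → ℝ},
      Literature.Analysis.FunctionSpaces.Torus.IsSmoothSpaceTimeOn (Set.Ico 0 T) ρ →
      (∀ t ∈ Set.Ico 0 T, ∀ x, 0 < σ ^ 3 * ρ t x ∧ σ ^ 3 * ρ t x < η) →
      Literature.Analysis.FunctionSpaces.Torus.IsSmoothSpaceTimeOn (Set.Ico 0 T)
        (fun t x => ρ t x * Rf (σ ^ 3 * ρ t x)) := by
  obtain ⟨r', hr', Rf', ⟨pw, hpw⟩, -, -, hsol', hbd', -, -⟩ :=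
    Summit.AtomisticToContinuum.HydrodynamicLimit.Theorems.stub_eosRatioAnalytic
  refine ⟨min r r', lt_min hr hr', min_le_left _ _, fun {T σ ρ} hρ hrange => ?_⟩
  -- `Rf = Rf'` on `(0, min r r')`
  have heq : Set.EqOn Rf' Rf (Set.Ioo 0 (min r r')) := by
    intro x hx
    have hxr : x ∈ Set.Ioo (-r) r := ⟨by linarith [hx.1], hx.2.trans_le (min_le_left _ _)⟩
    have hxr' : x ∈ Set.Ioo (-r') r' := ⟨by linarith [hx.1], hx.2.trans_le (min_le_right _ _)⟩
    have hb := hbd' x ⟨hx.1.le, (hx.2.trans_le (min_le_right _ _)).le⟩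
    exact huniq x hxr (Rf' x) ⟨by linarith [hb.1], hb.2⟩ (hsol' x hxr').2
  -- `Rf'` is smooth on the ball, hence `Rf` on `(0, min r r')`
  have hsmooth' : ContDiffOn ℝ ((⊤ : ℕ∞) : WithTop ℕ∞) Rf' (Set.Ioo 0 (min r r')) := by
    intro x hx
    have hxball : x ∈ Metric.eball (0 : ℝ) (ENNReal.ofReal r') := by
      rw [Metric.eball_ofReal, Metric.mem_ball, dist_zero_right, Real.norm_eq_abs, abs_lt]
      exact ⟨by linarith [hx.1], hx.2.trans_le (min_le_right _ _)⟩
    exact (hpw.analyticAt_of_mem hxball).contDiffAt.contDiffWithinAt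
  have hsmooth : ContDiffOn ℝ ((⊤ : ℕ∞) : WithTop ℕ∞) Rf (Set.Ioo 0 (min r r')) :=
    hsmooth'.congr fun x hx => (heq hx).symm
  show ContDiffOn ℝ _ (fun p => Literature.Analysis.FunctionSpaces.Torus.stLift ρ p *
    Rf (σ ^ 3 * Literature.Analysis.FunctionSpaces.Torus.stLift ρ p)) _
  refine ContDiffOn.mul hρ (hsmooth.comp (contDiffOn_const.mul hρ) fun p hp => ?_)
  exact hrange p.1 (Set.mem_prod.1 hp).1 _


/-! ## §2 Hearts ⇒ ESTIMATE -/

/-- **The two hearts and dilute self-consistency imply the ESTIMATE** (in-window bootstrap: bands from `DiluteSelfConsistency`, activity smoothness, uniform profile bounds on `[0,t]` + the a priori bound p125903, `P(s,s′) ≤ C(s′−s)M + 2ε₁(N+1)` from B2 (p133972) + P3Λ + P4Λ, `H(r′) − H(s) ≤ P(s,r′)` from `ledgerFormula_Hent`, one bootstrap of the window supremum, constants `A = 2(C₃+C₄)`, `w = min 1 (ε/(2C²C₀+2CC₀+1))`, `ε₁ = wε/(4(Cw+1))`). [cite: Yau1991, §2] -/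
theorem windowProductionEstimateLambda_of_hearts : Summit.AtomisticToContinuum.HydrodynamicLimit.Theorems.LambertianContactSwapLambertianEulerHearts.KineticOneBlockInMeanLambda → Summit.AtomisticToContinuum.HydrodynamicLimit.Theorems.LambertianContactSwapLambertianEulerHearts.CollisionalOneBlockInMeanLambda → Summit.AtomisticToContinuum.HydrodynamicLimit.Theses.ImplosionDichotomy.DiluteSelfConsistency → Summit.AtomisticToContinuum.HydrodynamicLimit.Theorems.LambertianContactSwapLambertianEulerHearts.WindowProductionEstimateLambda := by
  intro h3 h4 hS r Rf hr hsol hbd hcont huniq a₀ θ₀ u₀ ha hθ hu ha0 hθ0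
  -- the three v30 stubs (split + the two hearts) and the smoothness of the explicit activity
  obtain ⟨ηb, hηb, HB⟩ := Summit.AtomisticToContinuum.HydrodynamicLimit.Theorems.LambertianContactSwapLambertianEulerProductionSplit.stub_productionSplitLambda r Rf hr hsol hbd hcont huniq
  obtain ⟨η3, hη3, H3⟩ := h3 r Rf hr hsol hbd hcont huniq
  obtain ⟨η4, hη4, H4⟩ := h4 r Rf hr hsol hbd hcont huniq
  obtain ⟨σ3, hσ3, H3⟩ := H3 a₀ θ₀ u₀ ha hθ hu ha0 hθ0
  obtain ⟨σ4, hσ4, H4⟩ := H4 a₀ θ₀ u₀ ha hθ hu ha0 hθ0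
  obtain ⟨ηF, hηF, hηFr, Hsm⟩ := isSmoothSpaceTimeOn_activityRf hr huniq
  have hη : 0 < min ηb (min η3 (min η4 ηF)) := lt_min hηb (lt_min hη3 (lt_min hη4 hηF))
  obtain ⟨σS, hσS, HS⟩ := hS (min ηb (min η3 (min η4 ηF))) hη a₀ θ₀ u₀ ha hθ hu ha0 hθ0
  refine ⟨min σ3 (min σ4 (min σS 2⁻¹)), lt_min hσ3 (lt_min hσ4 (lt_min hσS (by norm_num))), ?_⟩
  intro σ hσ hσlt T ρ θ u hE Φ htie t ht
  have hσ3' : σ < σ3 := hσlt.trans_le (min_le_left _ _)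
  have hσ4' : σ < σ4 := hσlt.trans_le ((min_le_right _ _).trans (min_le_left _ _))
  have hσS' : σ < σS := hσlt.trans_le ((min_le_right _ _).trans ((min_le_right _ _).trans (min_le_left _ _)))
  have hσi : σ < 2⁻¹ := hσlt.trans_le ((min_le_right _ _).trans ((min_le_right _ _).trans (min_le_right _ _)))
  have hσ3pos : 0 < σ ^ 3 := by positivity
  -- the packing bands supplied by dilute self-consistency
  have hband : ∀ t' ∈ Set.Ico 0 T, ∀ x, ρ t' x * σ ^ 3 < min ηb (min η3 (min η4 ηF)) := fun t' ht' x =>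
    HS σ hσ hσS' T ρ θ u hE Φ htie t' ht' x
  have hbandb : ∀ t' ∈ Set.Ico 0 T, ∀ x, ρ t' x * σ ^ 3 < ηb := fun t' ht' x =>
    (hband t' ht' x).trans_le (min_le_left _ _)
  have hband3 : ∀ t' ∈ Set.Ico 0 T, ∀ x, ρ t' x * σ ^ 3 < η3 := fun t' ht' x =>
    (hband t' ht' x).trans_le ((min_le_right _ _).trans (min_le_left _ _))
  have hband4 : ∀ t' ∈ Set.Ico 0 T, ∀ x, ρ t' x * σ ^ 3 < η4 := fun t' ht' x =>
    (hband t' ht' x).trans_le ((min_le_right _ _).trans ((min_le_right _ _).trans (min_le_left _ _)))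
  have hbandF : ∀ t' ∈ Set.Ico 0 T, ∀ x, 0 < σ ^ 3 * ρ t' x ∧ σ ^ 3 * ρ t' x < ηF := fun t' ht' x =>
    ⟨mul_pos hσ3pos (hE.density_pos t' ht' x), by
      have h := (hband t' ht' x).trans_le ((min_le_right _ _).trans ((min_le_right _ _).trans (min_le_right _ _)))
      nlinarith [h]⟩
  have hsmooth : Literature.Analysis.FunctionSpaces.Torus.IsSmoothSpaceTimeOn (Set.Ico 0 T)
      (fun r' x => ρ r' x * Rf (σ ^ 3 * ρ r' x)) := Hsm hE.smooth_density hbandF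
  have hapos : ∀ t' ∈ Set.Ico 0 T, ∀ x, 0 < ρ t' x * Rf (σ ^ 3 * ρ t' x) := fun t' ht' x =>
    mul_pos (hE.density_pos t' ht' x)
      (hsol _ ⟨by linarith [(hbandF t' ht' x).1], (hbandF t' ht' x).2.trans_le hηFr⟩).1
  -- the one-block constants at this horizon
  obtain ⟨C3, hC3, K3⟩ := H3 σ hσ hσ3' T ρ θ u hE hband3 Φ htie t ht
  obtain ⟨C4, hC4, K4⟩ := H4 σ hσ hσ4' T ρ θ u hE hband4 Φ htie t ht
  -- uniform profile bounds on `[0, t]` and the a priori entropy bound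
  have h0tT : (0 : ℝ) + t < T := by rw [zero_add]; exact ht.2
  have hbne : ∀ p ∈ Set.Ico 0 T ×ˢ (Set.univ : Set V3),
      Literature.Analysis.FunctionSpaces.Torus.stLift (fun r' x => ρ r' x * Rf (σ ^ 3 * ρ r' x)) p ≠ 0 :=
    fun p hp => (hapos p.1 (Set.mem_prod.1 hp).1 _).ne'
  have hθne : ∀ p ∈ Set.Ico 0 T ×ˢ (Set.univ : Set V3),
      Literature.Analysis.FunctionSpaces.Torus.stLift θ p ≠ 0 :=
    fun p hp => (hE.temperature_pos p.1 (Set.mem_prod.1 hp).1 _).ne'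
  obtain ⟨B₁, hB₁, h₁⟩ :=
    Summit.AtomisticToContinuum.HydrodynamicLimit.Theorems.LambertianContactSwapLambertianEulerExpectedWindowProductionTools.exists_norm_le_of_continuousOn_window
      (hsmooth.continuousOn_stLift.log hbne) le_rfl h0tT
  obtain ⟨B₂, hB₂, h₂⟩ :=
    Summit.AtomisticToContinuum.HydrodynamicLimit.Theorems.LambertianContactSwapLambertianEulerExpectedWindowProductionTools.exists_norm_le_of_continuousOn_window
      (hE.smooth_temperature.continuousOn_stLift.log hθne) le_rfl h0tT
  obtain ⟨W, hW, h₃⟩ :=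
    Summit.AtomisticToContinuum.HydrodynamicLimit.Theorems.LambertianContactSwapLambertianEulerExpectedWindowProductionTools.exists_norm_le_of_continuousOn_window
      hE.smooth_velocity.continuousOn_stLift.norm le_rfl h0tT
  have hprof : ∀ r' ∈ Set.Icc 0 t, ∀ x : T3,
      (Real.exp (-(B₁ + B₂)) ≤ ρ r' x * Rf (σ ^ 3 * ρ r' x) ∧ ρ r' x * Rf (σ ^ 3 * ρ r' x) ≤ Real.exp (B₁ + B₂) + W) ∧
      (Real.exp (-(B₁ + B₂)) ≤ θ r' x ∧ θ r' x ≤ Real.exp (B₁ + B₂) + W) ∧ ‖u r' x‖ ≤ Real.exp (B₁ + B₂) + W := by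
    intro r' hr' x
    have hr'0 : r' ∈ Set.Icc 0 (0 + t) := by rw [zero_add]; exact hr'
    have hr'T : r' ∈ Set.Ico 0 T := ⟨hr'.1, hr'.2.trans_lt ht.2⟩
    have e₁ : Literature.Analysis.FunctionSpaces.Torus.stLift (fun r' x => ρ r' x * Rf (σ ^ 3 * ρ r' x))
        (r', Literature.Analysis.FunctionSpaces.Torus.repr x) = ρ r' x * Rf (σ ^ 3 * ρ r' x) := by
      rw [Literature.Analysis.FunctionSpaces.Torus.stLift_apply, Literature.Analysis.FunctionSpaces.Torus.proj_repr]
    have e₂ : Literature.Analysis.FunctionSpaces.Torus.stLift θ (r', Literature.Analysis.FunctionSpaces.Torus.repr x) =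
        θ r' x := by
      rw [Literature.Analysis.FunctionSpaces.Torus.stLift_apply, Literature.Analysis.FunctionSpaces.Torus.proj_repr]
    have e₃ : Literature.Analysis.FunctionSpaces.Torus.stLift u (r', Literature.Analysis.FunctionSpaces.Torus.repr x) =
        u r' x := by
      rw [Literature.Analysis.FunctionSpaces.Torus.stLift_apply, Literature.Analysis.FunctionSpaces.Torus.proj_repr]
    have hl₁ : |Real.log (ρ r' x * Rf (σ ^ 3 * ρ r' x))| ≤ B₁ := by
      have h := h₁ r' hr'0 x; rwa [Real.norm_eq_abs, e₁] at h
    have hl₂ : |Real.log (θ r' x)| ≤ B₂ := by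
      have h := h₂ r' hr'0 x; rwa [Real.norm_eq_abs, e₂] at h
    have hwx : ‖u r' x‖ ≤ W := by
      have h := h₃ r' hr'0 x
      rw [norm_norm, e₃] at h
      exact h
    have hb0 : 0 < ρ r' x * Rf (σ ^ 3 * ρ r' x) := hapos r' hr'T x
    have hθ0' : 0 < θ r' x := hE.temperature_pos r' hr'T x
    have hl₁' := abs_le.1 hl₁
    have hl₂' := abs_le.1 hl₂
    have hexp0 : 0 ≤ Real.exp (B₁ + B₂) := (Real.exp_pos _).le
    have hexpW : Real.exp (B₁ + B₂) ≤ Real.exp (B₁ + B₂) + W := le_add_of_nonneg_right hW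
    refine ⟨⟨?_, ?_⟩, ⟨?_, ?_⟩, ?_⟩
    · calc Real.exp (-(B₁ + B₂)) ≤ Real.exp (Real.log (ρ r' x * Rf (σ ^ 3 * ρ r' x))) :=
            Real.exp_le_exp.2 (by linarith)
        _ = ρ r' x * Rf (σ ^ 3 * ρ r' x) := Real.exp_log hb0
    · calc ρ r' x * Rf (σ ^ 3 * ρ r' x) = Real.exp (Real.log (ρ r' x * Rf (σ ^ 3 * ρ r' x))) :=
            (Real.exp_log hb0).symm
        _ ≤ Real.exp (B₁ + B₂) := Real.exp_le_exp.2 (by linarith)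
        _ ≤ Real.exp (B₁ + B₂) + W := hexpW
    · calc Real.exp (-(B₁ + B₂)) ≤ Real.exp (Real.log (θ r' x)) := Real.exp_le_exp.2 (by linarith)
        _ = θ r' x := Real.exp_log hθ0'
    · calc θ r' x = Real.exp (Real.log (θ r' x)) := (Real.exp_log hθ0').symm
        _ ≤ Real.exp (B₁ + B₂) := Real.exp_le_exp.2 (by linarith)
        _ ≤ Real.exp (B₁ + B₂) + W := hexpW
    · linarith
  obtain ⟨C₀', HC₀⟩ := Summit.AtomisticToContinuum.HydrodynamicLimit.Theorems.LambertianContactSwapLambertianEulerAprioriEntropyBound.stub_aprioriEntropyBoundLambda hσ hσi ha hθ hu ha0 hθ0 (Real.exp (-(B₁ + B₂)))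
    (Real.exp (B₁ + B₂) + W) (Real.exp_pos _)
  have hapr : ∀ (N : ℕ), ∀ r' ∈ Set.Icc 0 t,
      Hent σ a₀ θ₀ u₀ Rf ρ θ u N (Φ N) r' ≤ max C₀' 0 * ((N : ℝ) + 1) := by
    intro N r' hr'
    have hr'T : r' ∈ Set.Ico 0 T := ⟨hr'.1, hr'.2.trans_lt ht.2⟩
    have hbc : Continuous fun x => ρ r' x * Rf (σ ^ 3 * ρ r' x) := (hsmooth.isSmooth_slice hr'T).continuous
    have hθc : Continuous (θ r') := (hE.smooth_temperature.isSmooth_slice hr'T).continuous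
    have huc : Continuous (u r') := (hE.smooth_velocity.isSmooth_slice hr'T).continuous
    have h := (HC₀ hbc hθc huc (fun x => (hprof r' hr' x).1) (fun x => (hprof r' hr' x).2.1)
      (fun x => (hprof r' hr' x).2.2) N (Φ N) r' hr'.1).2
    have hN0 : (0 : ℝ) ≤ (N : ℝ) + 1 := by positivity
    exact h.trans (mul_le_mul_of_nonneg_right (le_max_left _ _) hN0)
  -- abbreviations for the constants
  have hC₀ : 0 ≤ max C₀' 0 := le_max_right _ _
  have hC : 0 ≤ C3 + C4 := add_nonneg hC3 hC4
  refine ⟨2 * (C3 + C4), by positivity, fun ε hε => ?_⟩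
  -- the window length (constant in `N`) and the one-block tolerance
  have hD : 0 < 2 * (C3 + C4) ^ 2 * max C₀' 0 + 2 * (C3 + C4) * max C₀' 0 + 1 := by positivity
  have hw₀ : 0 < min 1 (ε / (2 * (C3 + C4) ^ 2 * max C₀' 0 + 2 * (C3 + C4) * max C₀' 0 + 1)) :=
    lt_min one_pos (div_pos hε hD)
  have hw₁ : min 1 (ε / (2 * (C3 + C4) ^ 2 * max C₀' 0 + 2 * (C3 + C4) * max C₀' 0 + 1)) ≤ 1 := min_le_left _ _
  have hwε : min 1 (ε / (2 * (C3 + C4) ^ 2 * max C₀' 0 + 2 * (C3 + C4) * max C₀' 0 + 1)) ≤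
      ε / (2 * (C3 + C4) ^ 2 * max C₀' 0 + 2 * (C3 + C4) * max C₀' 0 + 1) := min_le_right _ _
  generalize hw_def : min 1 (ε / (2 * (C3 + C4) ^ 2 * max C₀' 0 + 2 * (C3 + C4) * max C₀' 0 + 1)) = w₀
    at hw₀ hw₁ hwε
  generalize hC_def : C3 + C4 = C at hC hD hwε
  generalize hC₀_def : max C₀' 0 = C₀ at hC₀ hD hwε hapr
  have hε₁ : 0 < w₀ * ε / (4 * (C * w₀ + 1)) := by positivity
  obtain ⟨N3, hN3⟩ := K3 (w₀ * ε / (4 * (C * w₀ + 1))) hε₁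
  obtain ⟨N4, hN4⟩ := K4 (w₀ * ε / (4 * (C * w₀ + 1))) hε₁
  generalize hε₁_def : w₀ * ε / (4 * (C * w₀ + 1)) = ε₁ at hε₁ hN3 hN4
  -- two elementary consequences of the choice of constants
  have hkey₁ : C ^ 2 * C₀ * w₀ ≤ ε / 2 ∧ C * C₀ * w₀ ≤ ε / 2 := by
    have hle : w₀ * (2 * C ^ 2 * C₀ + 2 * C * C₀ + 1) ≤ ε := by
      rw [← le_div_iff₀ hD]; exact hwε
    constructor <;> nlinarith [mul_nonneg (mul_nonneg (sq_nonneg C) hC₀) hw₀.le,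
      mul_nonneg (mul_nonneg hC hC₀) hw₀.le, hw₀]
  have hkey₂ : 2 * ε₁ * (C * w₀ + 1) = w₀ * ε / 2 := by
    rw [← hε₁_def]; field_simp; ring
  refine ⟨fun _ => w₀, fun _ => hw₀, max N3 N4, fun N hN => ?_⟩
  have hN3' : N3 ≤ N := (le_max_left _ _).trans hN
  have hN4' : N4 ≤ N := (le_max_right _ _).trans hN
  have hN1 : (0 : ℝ) < (N : ℝ) + 1 := by positivity
  -- (P) the production of a sub-interval, given an entropy bound on it
  have hP : ∀ (s s' M : ℝ), 0 ≤ s → s ≤ s' → s' ≤ t →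
      (∀ r' ∈ Set.Icc s s', Hent σ a₀ θ₀ u₀ Rf ρ θ u N (Φ N) r' ≤ M) →
      dLZ σ Rf ρ N s s' - Sint σ a₀ θ₀ u₀ Rf ρ θ u T N (Φ N) s s' - Jmp σ a₀ θ₀ u₀ Rf ρ θ u N (Φ N) s s' ≤
        C * (s' - s) * M + 2 * ε₁ * ((N : ℝ) + 1) := by
    intro s s' M hs hss' hs't hM
    have hs'T : s' < T := hs't.trans_lt ht.2
    have hsplit : Sint σ a₀ θ₀ u₀ Rf ρ θ u T N (Φ N) s s' =
        Yint σ a₀ θ₀ u₀ θ u N (Φ N) s s' - Xint σ a₀ θ₀ u₀ ρ θ u N (Φ N) s s' :=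
      (HB hσ hσi ha hθ hu ha0 hθ0 T N (Φ N) ρ θ u hE hbandb s s' hs hss' hs'T).2.2
    have k3 : -(Yint σ a₀ θ₀ u₀ θ u N (Φ N) s s') ≤ C3 * (s' - s) * M + ε₁ * ((N : ℝ) + 1) :=
      hN3 N hN3' s s' M hs hss' hs't hM
    have k4 : -(Jmp σ a₀ θ₀ u₀ Rf ρ θ u N (Φ N) s s') + Xint σ a₀ θ₀ u₀ ρ θ u N (Φ N) s s' + dLZ σ Rf ρ N s s' ≤
        C4 * (s' - s) * M + ε₁ * ((N : ℝ) + 1) :=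
      hN4 N hN4' s s' M hs hss' hs't hM
    rw [← hC_def]
    linarith
  constructor
  · -- full windows `[s, s + w₀] ⊆ [0, t]`
    intro s hs hsw
    beta_reduce
    beta_reduce at hsw
    -- crude bound on the window from the a priori bound, then bootstrap once
    have hM₁ : ∀ r' ∈ Set.Icc s (s + w₀), Hent σ a₀ θ₀ u₀ Rf ρ θ u N (Φ N) r' ≤
        Hent σ a₀ θ₀ u₀ Rf ρ θ u N (Φ N) s + C * w₀ * (C₀ * ((N : ℝ) + 1)) + 2 * ε₁ * ((N : ℝ) + 1) := by
      intro r' hr'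
      have hl := ledgerFormula_Hent hσ hσi ha hθ hu ha0 hθ0 hE hsmooth hapos N (Φ N) hs hr'.1
        ((hr'.2.trans hsw).trans_lt ht.2)
      have hp := hP s r' (C₀ * ((N : ℝ) + 1)) hs hr'.1 (hr'.2.trans hsw)
        (fun r'' hr'' => hapr N r'' ⟨hs.trans hr''.1, (hr''.2.trans hr'.2).trans hsw⟩)
      have hX : 0 ≤ C₀ * ((N : ℝ) + 1) := by positivity
      have hcr : C * (r' - s) * (C₀ * ((N : ℝ) + 1)) ≤ C * w₀ * (C₀ * ((N : ℝ) + 1)) :=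
        mul_le_mul_of_nonneg_right (mul_le_mul_of_nonneg_left (by linarith [hr'.2]) hC) hX
      linarith [hl, hp, hcr]
    have hfin := hP s (s + w₀) _ hs (by linarith) hsw hM₁
    rw [show s + w₀ - s = w₀ by ring] at hfin
    exact estimate_arith_full hC hw₀ hN1 ENNReal.toReal_nonneg hfin hkey₁.1 hkey₂
  · -- the last partial window `s ≤ t ≤ s + w₀`
    intro s hs hst htsw
    beta_reduce at htsw
    have hp := hP s t (C₀ * ((N : ℝ) + 1)) hs hst le_rfl (fun r'' hr'' => hapr N r'' ⟨hs.trans hr''.1, hr''.2⟩)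
    exact estimate_arith_partial hC hC₀ hw₀ hw₁ hN1 hε hε₁ (by linarith) hp hkey₁.2 hkey₂

end Summit.AtomisticToContinuum.HydrodynamicLimit.Theorems.LambertianContactSwapLambertianEulerEstimateOfHearts
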